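import Literature.IUT.HodgeTheaters.DiscreteProfiniteCompletionsNonabelian
import Literature.IUT.HodgeTheaters.ProfiniteCompletionCentralizersCS
import Literature.GroupTheory.FiniteAbelian.QuotientCyclicRank
import Mathlib.GroupTheory.Schreier
import HarnessLib

/-!
# [IUTchI] Theorem 2.6 for an ABSTRACT finite-index subgroup: hereditary conjugacy separability,
# Lemma 2.7 (iii)/(iv) and cyclic centralizers suffice

Mochizuki, *Inter-universal Teichmüller theory I*, kurims manuscript (May 2020), §2, Theorem 2.6,
p. 56, proof pp. 56–57 [cite: Mochizuki2012, Thm 2.6 pp.56-57] (D-0012 claim key; series status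
DISPUTED — the content of this file is classical combinatorial / profinite group theory and takes no
side; Remark 2.8.1: the orientable-surface case is OFF the route actually used in [IUTchI–IV]).

The tree proves Theorem 2.6 for `G` FREE of finite rank (abc-iut-L5-t9, `profiniteConjugates_freeCase`).
The printed proof for an orientable surface group `G` uses: conjugacy separability ("[Stb2], Theorem
3.3", p. 57 l. 9, applied to `G` AND to the finite-index subgroups of `G` produced by Lemma 2.7
(ii)/(iii)), Lemma 2.7 (iii), Lemma 2.7 (iv), and — in place of the instances of Lemma 2.7 (v) invoked
on p. 57, as in the free-case files — the CENTRALIZER CONDITION in `F̂`, derived from HEREDITARY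
conjugacy separability in `ProfiniteCompletionCentralizersCS.lean`.  This file proves Theorem 2.6 for
an ABSTRACT finite-index subgroup `G ⊆ F` carrying these properties as hypotheses:

* (HCS) every finite-index subgroup `K ⊆ F` with `K ⊆ G` is conjugacy separable;
* (III) Lemma 2.7 (iii) for `G`;
* (Z)   centralizers of non-trivial elements of `G` are cyclic;
* (IV)  abelian subgroups of `G` are cyclic (Lemma 2.7 (iv));
* (FG)  `G` is finitely generated.

Results: `exists_hom_ne_one_eq_one_of_fg` (separating characters `K → ℤ` from independence in `K^{ab}`,
`K` finitely generated — structure theorem via the tree's `isOfFinAddOrder_of_forall_addMonoidHom_eq_zero`),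
`exists_inv_mul_commute_of_conjSeparable` (the centralizing translate, abstract `K`),
`profiniteConjugates_b_of_hcs` (assertion (b)), `profiniteConjugates_a_abelian_of_hcs` (assertion (a),
abelian `H_G`), `profiniteConjugates_of_hcs` (both assertions), `residuallyFinite_of_conjSeparable`.
The companion `DiscreteProfiniteConjugatesSurfaceHCS.lean` reduces the NAMED statements (Thm 2.6,
Cor 2.8, Lem 2.7 (vi)(vii)) to these properties OF ORIENTABLE SURFACE GROUPS, i.e. to (HCS) = [Stb2]
Thm 3.3 + the Lemma 2.7 (iii)/(iv) surface halves (abc-iut-L5-d1) + cyclic centralizers / finite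
generation of surface groups.  Proof-only file; no statement of the tree is restated or weakened;
nothing about surface groups is proved here.
-/

namespace Literature.IUT.HodgeTheaters

open scoped Pointwise
open ProfiniteCompletion

universe u

/-! ### Separating characters over a finitely generated abelianization -/

/-- **Separating character.**  Let `K` be a finitely generated group and `a, b ∈ K` elements whose
images in `K^{ab}` satisfy no non-trivial relation `ā^i b̄^j = 1`.  Then there is a homomorphism
`f : K → ℤ` with `f(a) ≠ 0 = f(b)` (structure theorem for the finitely generated abelian group
`K^{ab}/⟨b̄⟩`, in which `ā` has infinite order).  For `K` free this is
`FreeOrSurface.exists_hom_ne_one_eq_one`. [cite: Mochizuki2012, Thm 2.6 p.57] -/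
theorem exists_hom_ne_one_eq_one_of_fg (K : Type u) [Group K] [Group.FG K] (a b : K)
    (hind : ∀ i j : ℤ, Abelianization.of a ^ i * Abelianization.of b ^ j = 1 → i = 0 ∧ j = 0) :
    ∃ f : K →* Multiplicative ℤ, f a ≠ 1 ∧ f b = 1 := by
  classical
  -- the finitely generated abelian group `M = K^{ab}` (additively) and `N = M ⧸ ⟨b̄⟩`
  have hsurj : Function.Surjective (Abelianization.of : K →* Abelianization K) := by
    intro z
    obtain ⟨g, hg⟩ := QuotientGroup.mk_surjective z
    exact ⟨g, hg⟩
  haveI : Group.FG (Abelianization K) := Group.fg_of_surjective hsurj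
  let M := Additive (Abelianization K)
  let bM : M := Additive.ofMul (Abelianization.of b)
  let aM : M := Additive.ofMul (Abelianization.of a)
  let S : AddSubgroup M := AddSubgroup.zmultiples bM
  haveI : AddGroup.FG (M ⧸ S) := QuotientAddGroup.fg S
  -- the class of `ā` in `N` has infinite order
  have hinf : ¬ IsOfFinAddOrder (QuotientAddGroup.mk aM : M ⧸ S) := by
    intro hfin
    obtain ⟨n, hn, hnz⟩ := hfin.exists_nsmul_eq_zero
    rw [← QuotientAddGroup.mk_nsmul, QuotientAddGroup.eq_zero_iff] at hnz
    obtain ⟨m, hm⟩ := AddSubgroup.mem_zmultiples_iff.mp hnz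
    -- `m • b̄ = n • ā`, i.e. `ā ^ n * b̄ ^ (-m) = 1`
    have hrel : Abelianization.of a ^ (n : ℤ) * Abelianization.of b ^ (-m) = 1 := by
      have h1 : Additive.toMul (m • bM) = Additive.toMul ((n : ℤ) • aM) := by
        rw [hm, natCast_zsmul]
      rw [toMul_zsmul, toMul_zsmul] at h1
      change Abelianization.of b ^ m = Abelianization.of a ^ (n : ℤ) at h1
      rw [← h1, zpow_neg, mul_inv_cancel]
    have := (hind n (-m) hrel).1
    omega
  -- hence some functional `N → ℤ` does not kill it
  have hφ : ∃ φ : M ⧸ S →+ ℤ, φ (QuotientAddGroup.mk aM) ≠ 0 := by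
    by_contra hno
    push Not at hno
    exact hinf (Literature.GroupTheory.FiniteAbelian.isOfFinAddOrder_of_forall_addMonoidHom_eq_zero hno)
  obtain ⟨φ, hφa⟩ := hφ
  -- assemble `f : K → ℤ`
  let ψ : M →+ ℤ := φ.comp (QuotientAddGroup.mk' S)
  let f : Abelianization K →* Multiplicative ℤ := AddMonoidHom.toMultiplicativeRight ψ
  refine ⟨f.comp Abelianization.of, ?_, ?_⟩
  · intro h
    apply hφa
    have h' : f (Abelianization.of a) = 1 := h
    have h'' : Multiplicative.ofAdd (ψ aM) = 1 := h'
    exact ofAdd_eq_one.mp h''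
  · change f (Abelianization.of b) = 1
    change Multiplicative.ofAdd (ψ bM) = 1
    rw [ofAdd_eq_one]
    change φ (QuotientAddGroup.mk' S bM) = 0
    rw [QuotientAddGroup.mk'_apply, (QuotientAddGroup.eq_zero_iff bM).mpr (AddSubgroup.mem_zmultiples bM),
      map_zero]

/-! ### Theorem 2.6 (b) for a hereditarily conjugacy separable finite-index subgroup -/

section PartB

variable {F : Type u} [Group F]

/-- The centralizing translate (p. 57), ABSTRACT form: if `γ'` has trivial component at the normal core
of the finite-index subgroup `K`, conjugates `η(h)` (`h ∈ K`) into `η(F)`, and `K` is conjugacy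
separable, then `η(ε)⁻¹ γ'` commutes with `η(h)` for some `ε ∈ K`.  (For `K` free of finite rank:
`exists_inv_mul_commute`.) [cite: Mochizuki2012, Thm 2.6 p.57] -/
theorem exists_inv_mul_commute_of_conjSeparable (K : Subgroup F) [K.FiniteIndex]
    (hK : ∀ u v : K, ¬ IsConj u v →
      ∃ (L : Subgroup K) (_ : L.Normal) (_ : L.FiniteIndex),
        ¬ IsConj (QuotientGroup.mk u : K ⧸ L) (QuotientGroup.mk v))
    (γ' : profiniteCompletion F)
    (hγ' : γ'.val (FiniteIndexNormalSubgroup.ofSubgroup K.normalCore) = 1)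
    {h : F} (hhK : h ∈ K) (hconj : γ' * toCompletion F h * γ'⁻¹ ∈ (toCompletion F).range) :
    ∃ ε ∈ K, (toCompletion F ε)⁻¹ * γ' * toCompletion F h =
      toCompletion F h * ((toCompletion F ε)⁻¹ * γ') := by
  obtain ⟨g', hg'⟩ := hconj
  have hconj' : γ' * toCompletion F h * γ'⁻¹ = toCompletion F g' := hg'.symm
  have hg'K : g' ∈ K := mem_of_conj_eq_of_val_normalCore_eq_one K γ' hγ' hhK hconj'
  have hc : IsConj (⟨h, hhK⟩ : K) ⟨g', hg'K⟩ := by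
    by_contra hnc
    obtain ⟨L, hLn, hLf, hL⟩ := hK _ _ hnc
    exact hL (isConj_mk_of_conj_eq_of_val_normalCore_eq_one K γ' hγ' hhK hg'K hconj' L)
  obtain ⟨ε, hε⟩ := isConj_iff.mp hc
  have hε' : (ε : F) * h * (ε : F)⁻¹ = g' := by simpa using congrArg Subtype.val hε
  refine ⟨ε, ε.2, ?_⟩
  rw [← hε', map_mul, map_mul, map_inv] at hconj'
  have e1 : (toCompletion F ε)⁻¹ * γ' * toCompletion F h =
      (toCompletion F ε)⁻¹ * (γ' * toCompletion F h * γ'⁻¹) * γ' := by group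
  rw [e1, hconj']
  group

/-- Cyclic centralizers descend to subgroups: if the centralizer in `G` of every non-trivial element is
cyclic and `K ⊆ G`, then for `u ∈ K`, `u ≠ 1`, the centralizer of `u` in `K` is `⟨r⟩` for some `r ∈ K`.
[cite: Mochizuki2012, Thm 2.6 p.57] -/
theorem exists_centralizer_eq_zpowers_of_le {G K : Subgroup F} (hKG : K ≤ G)
    (hZ : ∀ u : G, u ≠ 1 → IsCyclic (Subgroup.centralizer ({u} : Set G)))
    (u : K) (hu : u ≠ 1) :
    ∃ r : K, Subgroup.centralizer ({u} : Set K) = Subgroup.zpowers r := by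
  set uG : G := ⟨(u : F), hKG u.2⟩ with huG
  have huG1 : uG ≠ 1 := fun h => hu (Subtype.ext (by simpa [huG] using congrArg Subtype.val h))
  haveI := hZ uG huG1
  -- the inclusion `C_K(u) → C_G(u)`
  let ι : Subgroup.centralizer ({u} : Set K) →* Subgroup.centralizer ({uG} : Set G) :=
    { toFun := fun c => ⟨⟨(c : K), hKG (c : K).2⟩, by
        rw [Subgroup.mem_centralizer_iff]
        intro w hw
        rw [Set.mem_singleton_iff] at hw
        subst hw
        have hc := Subgroup.mem_centralizer_iff.mp c.2 u (Set.mem_singleton u)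
        exact Subtype.ext (by simpa [huG] using congrArg Subtype.val hc)⟩
      map_one' := rfl
      map_mul' := fun _ _ => rfl }
  have hι : Function.Injective ι := by
    intro c d hcd
    have h1 : ((ι c : G) : F) = ((ι d : G) : F) := by rw [hcd]
    exact Subtype.ext (Subtype.ext h1)
  have hcyc : IsCyclic (Subgroup.centralizer ({u} : Set K)) := isCyclic_of_injective ι hι
  exact (Subgroup.isCyclic_iff_exists_zpowers_eq_top _).mp hcyc |>.imp fun r hr => hr.symm

/-- **Theorem 2.6 (b) for a hereditarily conjugacy separable finite-index subgroup.**  Let `G ⊆ F`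
be of finite index, finitely generated, hereditarily conjugacy separable (HCS), with cyclic centralizers
of non-trivial elements (Z) and satisfying Lemma 2.7 (iii) (III); let `H ⊆ F` and `γ ∈ F̂` conjugate
`η(H)` into `η(F)`, with `H_G = H ∩ G` nonabelian.  Then `γ ∈ η(F)`.  Route of p. 57 with the centralizer
condition (from HCS) in place of the instances of Lemma 2.7 (v), word for word the free-case argument
`profiniteConjugates_b_freeCase_of_rankTwo`. [cite: Mochizuki2012, Thm 2.6 pp.56-57] -/
theorem profiniteConjugates_b_of_hcs (G H : Subgroup F) [G.FiniteIndex] (hfg : Group.FG G)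
    (hHCS : ∀ K : Subgroup F, K ≤ G → K.FiniteIndex → ∀ u v : K, ¬ IsConj u v →
      ∃ (L : Subgroup K) (_ : L.Normal) (_ : L.FiniteIndex),
        ¬ IsConj (QuotientGroup.mk u : K ⧸ L) (QuotientGroup.mk v))
    (hZ : ∀ u : G, u ≠ 1 → IsCyclic (Subgroup.centralizer ({u} : Set G)))
    (hIII : ∀ x y : G, x * y ≠ y * x →
      ∃ (G₁ : Subgroup G) (n : ℕ) (hx : x ^ n ∈ G₁) (hy : y ^ n ∈ G₁), G₁.FiniteIndex ∧ 0 < n ∧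
        ∀ i j : ℤ, Abelianization.of (⟨x ^ n, hx⟩ : G₁) ^ i *
          Abelianization.of (⟨y ^ n, hy⟩ : G₁) ^ j = 1 → i = 0 ∧ j = 0)
    (γ : profiniteCompletion F)
    (hγ : ∀ h ∈ H, γ * toCompletion F h * γ⁻¹ ∈ (toCompletion F).range)
    (hna : ∃ x ∈ H ⊓ G, ∃ y ∈ H ⊓ G, x * y ≠ y * x) :
    γ ∈ (toCompletion F).range := by
  obtain ⟨x, hx, y, hy, hxy⟩ := hna
  obtain ⟨hxH, hxG⟩ := Subgroup.mem_inf.mp hx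
  obtain ⟨hyH, hyG⟩ := Subgroup.mem_inf.mp hy
  haveI := hfg
  -- Lemma 2.7 (iii) in `G`
  have hxy' : (⟨x, hxG⟩ : G) * ⟨y, hyG⟩ ≠ ⟨y, hyG⟩ * ⟨x, hxG⟩ :=
    fun h => hxy (by simpa using congrArg Subtype.val h)
  obtain ⟨G₁, n, hxn, hyn, hG₁fi, hn, hind⟩ := hIII ⟨x, hxG⟩ ⟨y, hyG⟩ hxy'
  haveI := hG₁fi
  -- the finite index subgroup `K = G₁ ⊆ F` and the elements `u = xⁿ`, `v = yⁿ`
  set K : Subgroup F := G₁.map G.subtype with hKdef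
  haveI hKfi : K.FiniteIndex := by
    constructor
    rw [hKdef, Subgroup.index_map_subtype]
    exact mul_ne_zero Subgroup.FiniteIndex.index_ne_zero Subgroup.FiniteIndex.index_ne_zero
  have hKG : K ≤ G := by
    rw [hKdef]; exact Subgroup.map_subtype_le G₁
  set e : G₁ ≃* K := Subgroup.equivMapOfInjective G₁ G.subtype (Subgroup.subtype_injective G) with hedef
  haveI hKfg : Group.FG K := Group.fg_of_surjective (f := e.toMonoidHom) e.surjective
  have hKcs := hHCS K hKG hKfi
  set u : F := x ^ n with hu
  set v : F := y ^ n with hv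
  have huK : u ∈ K := ⟨⟨x, hxG⟩ ^ n, hxn, by simp [hu]⟩
  have hvK : v ∈ K := ⟨⟨y, hyG⟩ ^ n, hyn, by simp [hv]⟩
  have huH : u ∈ H := H.pow_mem hxH n
  have hvH : v ∈ H := H.pow_mem hyH n
  -- independence of `ū, v̄` in `K^{ab}`, transported along `e : G₁ ≃* K`
  have heU : e ⟨⟨x, hxG⟩ ^ n, hxn⟩ = ⟨u, huK⟩ :=
    Subtype.ext (by rw [hedef, Subgroup.coe_equivMapOfInjective_apply]; simp [hu])
  have heV : e ⟨⟨y, hyG⟩ ^ n, hyn⟩ = ⟨v, hvK⟩ :=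
    Subtype.ext (by rw [hedef, Subgroup.coe_equivMapOfInjective_apply]; simp [hv])
  have hindK : ∀ i j : ℤ, Abelianization.of (⟨u, huK⟩ : K) ^ i *
      Abelianization.of (⟨v, hvK⟩ : K) ^ j = 1 → i = 0 ∧ j = 0 := by
    intro i j hrel
    apply hind i j
    have h1 := congrArg (Abelianization.map e.symm.toMonoidHom) hrel
    rw [map_mul, map_zpow, map_zpow, Abelianization.map_of, Abelianization.map_of, map_one,
      MulEquiv.coe_toMonoidHom, ← heU, ← heV, e.symm_apply_apply, e.symm_apply_apply] at h1
    exact h1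
  have hindK' : ∀ i j : ℤ, Abelianization.of (⟨v, hvK⟩ : K) ^ i *
      Abelianization.of (⟨u, huK⟩ : K) ^ j = 1 → i = 0 ∧ j = 0 := by
    intro i j hrel
    rw [mul_comm] at hrel
    exact (hindK j i hrel).symm
  -- `u, v ≠ 1`
  have hu1 : (⟨u, huK⟩ : K) ≠ 1 := by
    intro h1
    have := (hindK 1 0 (by rw [h1]; simp)).1
    exact one_ne_zero this
  have hv1 : (⟨v, hvK⟩ : K) ≠ 1 := by
    intro h1
    have := (hindK' 1 0 (by rw [h1]; simp)).1
    exact one_ne_zero this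
  -- separating character `f₁ : K → ℤ`, `f₁(u) ≠ 0 = f₁(v)`
  obtain ⟨f₁, hf₁u, hf₁v⟩ := exists_hom_ne_one_eq_one_of_fg K ⟨u, huK⟩ ⟨v, hvK⟩ hindK
  -- the cyclic centralizers `Z_K(u) = ⟨R_u⟩`, `Z_K(v) = ⟨R_v⟩`
  obtain ⟨Ru, hRu⟩ := exists_centralizer_eq_zpowers_of_le hKG hZ ⟨u, huK⟩ hu1
  obtain ⟨Rv, hRv⟩ := exists_centralizer_eq_zpowers_of_le hKG hZ ⟨v, hvK⟩ hv1
  have hZu : ∀ c ∈ K, c * u = u * c → c ∈ Subgroup.zpowers (Ru : F) := by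
    intro c hcK hc
    have hmem : (⟨c, hcK⟩ : K) ∈ Subgroup.centralizer ({(⟨u, huK⟩ : K)} : Set K) := by
      rw [Subgroup.mem_centralizer_iff]
      intro w hw
      rw [Set.mem_singleton_iff] at hw
      subst hw
      exact Subtype.ext hc.symm
    rw [hRu] at hmem
    obtain ⟨k, hk⟩ := Subgroup.mem_zpowers_iff.mp hmem
    exact Subgroup.mem_zpowers_iff.mpr ⟨k, by simpa using congrArg Subtype.val hk⟩
  have hZv : ∀ c ∈ K, c * v = v * c → c ∈ Subgroup.zpowers (Rv : F) := by
    intro c hcK hc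
    have hmem : (⟨c, hcK⟩ : K) ∈ Subgroup.centralizer ({(⟨v, hvK⟩ : K)} : Set K) := by
      rw [Subgroup.mem_centralizer_iff]
      intro w hw
      rw [Set.mem_singleton_iff] at hw
      subst hw
      exact Subtype.ext hc.symm
    rw [hRv] at hmem
    obtain ⟨k, hk⟩ := Subgroup.mem_zpowers_iff.mp hmem
    exact Subgroup.mem_zpowers_iff.mpr ⟨k, by simpa using congrArg Subtype.val hk⟩
  -- `f₁(R_u) ≠ 0`, `f₁(R_v) = 0`
  have huRu : (⟨u, huK⟩ : K) ∈ Subgroup.zpowers Ru := by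
    rw [← hRu, Subgroup.mem_centralizer_iff]; simp
  have hvRv : (⟨v, hvK⟩ : K) ∈ Subgroup.zpowers Rv := by
    rw [← hRv, Subgroup.mem_centralizer_iff]; simp
  obtain ⟨p, hp⟩ := Subgroup.mem_zpowers_iff.mp huRu
  obtain ⟨q, hq⟩ := Subgroup.mem_zpowers_iff.mp hvRv
  have hf₁Ru : f₁ Ru ≠ 1 := FreeOrSurface.apply_root_ne_one f₁ hp hf₁u
  have hq0 : q ≠ 0 := by rintro rfl; exact hv1 (by rw [← hq, zpow_zero])
  have hf₁Rv : f₁ Rv = 1 := FreeOrSurface.apply_root_eq_one f₁ hq hq0 hf₁v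
  -- Step 1: `γ' = η(f)⁻¹ γ` with trivial component at the normal core of `K`
  obtain ⟨f, hγ'⟩ := exists_inv_mul_val_normalCore_eq_one K γ
  set γ' : profiniteCompletion F := (toCompletion F f)⁻¹ * γ with hγ'def
  have hγconj : ∀ h ∈ H, γ' * toCompletion F h * γ'⁻¹ ∈ (toCompletion F).range := by
    intro h hh
    obtain ⟨g, hg⟩ := hγ h hh
    refine ⟨f⁻¹ * g * f, ?_⟩
    rw [map_mul, map_mul, map_inv, hg, hγ'def]
    group
  -- Step 2: centralizing translates for `u` and `v` (conjugacy separability of `K`)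
  obtain ⟨εu, hεuK, hσu⟩ := exists_inv_mul_commute_of_conjSeparable K hKcs γ' hγ' huK (hγconj u huH)
  obtain ⟨εv, hεvK, hσv⟩ := exists_inv_mul_commute_of_conjSeparable K hKcs γ' hγ' hvK (hγconj v hvH)
  set σu : profiniteCompletion F := (toCompletion F εu)⁻¹ * γ' with hσudef
  set σv : profiniteCompletion F := (toCompletion F εv)⁻¹ * γ' with hσvdef
  -- Step 3: centralizer condition (from HCS of `K`) ⇒ `σ_u ∈ closure η⟨R_u⟩`, `σ_v ∈ closure η⟨R_v⟩`
  have hHCSK := ProfiniteCompletion.hcs_mono hKG hHCS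
  have hσuC := ProfiniteCompletion.mem_closure_centralizer_of_commute_of_hcs K hHCSK huK σu hσu
  have hσvC := ProfiniteCompletion.mem_closure_centralizer_of_commute_of_hcs K hHCSK hvK σv hσv
  have hσuZ : σu ∈ closure (toCompletion F '' (Subgroup.zpowers (Ru : F) : Set F)) :=
    mem_closure_zpowers_of_mem_closure_centralizer K hZu σu
      (exists_mem_val_eq_mk_of_inv_mul K γ' hγ' hεuK) hσuC
  have hσvZ : σv ∈ closure (toCompletion F '' (Subgroup.zpowers (Rv : F) : Set F)) :=
    mem_closure_zpowers_of_mem_closure_centralizer K hZv σv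
      (exists_mem_val_eq_mk_of_inv_mul K γ' hγ' hεvK) hσvC
  -- Step 4: the lattice step — `σ_v σ_u⁻¹ = η(εv⁻¹ εu)` and `f₁` separate, so `σ_u = η(R_u ^ c)`
  have hrel : σv * σu⁻¹ = toCompletion F (εv⁻¹ * εu) := by
    rw [hσudef, hσvdef, map_mul, map_inv]; group
  have hf₁Ru' : f₁ ⟨(Ru : F), Ru.2⟩ ≠ 1 := by simpa using hf₁Ru
  have hf₁Rv' : f₁ ⟨(Rv : F), Rv.2⟩ = 1 := by simpa using hf₁Rv
  obtain ⟨c, hc⟩ := ProfiniteConjugates.exists_eq_toCompletion_zpow K Ru.2 Rv.2 f₁ hf₁Ru' hf₁Rv'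
    hσuZ hσvZ hrel
  -- Step 5: `γ = η(f εu R_u^c)`
  refine ⟨f * εu * (Ru : F) ^ c, ?_⟩
  have e1 : γ = toCompletion F f * (toCompletion F εu * σu) := by
    rw [hσudef, hγ'def]; group
  rw [e1, hc, map_mul, map_mul]
  group

end PartB

/-! ### Theorem 2.6 (a) (abelian `H_G`) and the assembly -/

section Assembly

variable {F : Type u} [Group F]

/-- **Theorem 2.6 (a) for `H_G` abelian**, ABSTRACT form: `G ⊆ F` of finite index, conjugacy separable,
with abelian subgroups cyclic (Lemma 2.7 (iv)); `H_G = H ∩ G` abelian; `γ ∈ F̂` conjugating `η(H)` into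
`η(F)`.  Then `γ · η(H_G) · γ⁻¹ = η(δ) · η(H_G) · η(δ)⁻¹` for some `δ ∈ F` (t9's
`conj_map_eq_of_isCyclic_of_conjSeparable` once `H_G` is known to be cyclic).
[cite: Mochizuki2012, Thm 2.6 pp.56-57] -/
theorem profiniteConjugates_a_abelian_of_hcs (G H : Subgroup F) [G.FiniteIndex]
    (hCS : ∀ u v : G, ¬ IsConj u v →
      ∃ (L : Subgroup G) (_ : L.Normal) (_ : L.FiniteIndex),
        ¬ IsConj (QuotientGroup.mk u : G ⧸ L) (QuotientGroup.mk v))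
    (hIV : ∀ J : Subgroup G, (∀ a ∈ J, ∀ b ∈ J, a * b = b * a) → IsCyclic J)
    (hab : ∀ x ∈ H ⊓ G, ∀ y ∈ H ⊓ G, x * y = y * x)
    (γ : profiniteCompletion F)
    (hγ : ∀ h ∈ H, γ * toCompletion F h * γ⁻¹ ∈ (toCompletion F).range) :
    ∃ δ : F, MulAut.conj γ • (H ⊓ G).map (toCompletion F) =
      MulAut.conj (toCompletion F δ) • (H ⊓ G).map (toCompletion F) := by
  have hcyc : IsCyclic (H ⊓ G : Subgroup F) := by
    have h1 := hIV ((H ⊓ G).subgroupOf G) (fun a ha b hb => Subtype.ext (hab a ha b hb))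
    exact isCyclic_of_surjective (Subgroup.subgroupOfEquivOfLe (inf_le_right : H ⊓ G ≤ G)).toMonoidHom
      (Subgroup.subgroupOfEquivOfLe _).surjective
  exact conj_map_eq_of_isCyclic_of_conjSeparable G H hcyc hCS γ
    fun h hh => hγ h (Subgroup.mem_inf.mp hh).1

/-- **Theorem 2.6 for a hereditarily conjugacy separable finite-index subgroup** (both assertions):
`G ⊆ F` of finite index, finitely generated, with (HCS), (III), (Z), (IV) as in the module docstring;
`H ⊆ F`; `γ ∈ F̂` conjugating `η(H)` into `η(F)`.  Then (a) `γ · η(H_G) · γ⁻¹ = η(δ) · η(H_G) · η(δ)⁻¹`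
for some `δ ∈ F`, and (b) `γ ∈ η(F)` if `H_G` is nonabelian ("`H` infinite" is not needed).  For `G`
free of finite rank every hypothesis is a theorem of the tree (`profiniteConjugates_freeCase`).
[cite: Mochizuki2012, Thm 2.6 pp.56-57] -/
theorem profiniteConjugates_of_hcs (G H : Subgroup F) [G.FiniteIndex] (hfg : Group.FG G)
    (hHCS : ∀ K : Subgroup F, K ≤ G → K.FiniteIndex → ∀ u v : K, ¬ IsConj u v →
      ∃ (L : Subgroup K) (_ : L.Normal) (_ : L.FiniteIndex),
        ¬ IsConj (QuotientGroup.mk u : K ⧸ L) (QuotientGroup.mk v))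
    (hIII : ∀ x y : G, x * y ≠ y * x →
      ∃ (G₁ : Subgroup G) (n : ℕ) (hx : x ^ n ∈ G₁) (hy : y ^ n ∈ G₁), G₁.FiniteIndex ∧ 0 < n ∧
        ∀ i j : ℤ, Abelianization.of (⟨x ^ n, hx⟩ : G₁) ^ i *
          Abelianization.of (⟨y ^ n, hy⟩ : G₁) ^ j = 1 → i = 0 ∧ j = 0)
    (hZ : ∀ u : G, u ≠ 1 → IsCyclic (Subgroup.centralizer ({u} : Set G)))
    (hIV : ∀ J : Subgroup G, (∀ a ∈ J, ∀ b ∈ J, a * b = b * a) → IsCyclic J)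
    (γ : profiniteCompletion F)
    (hγ : ∀ h ∈ H, γ * toCompletion F h * γ⁻¹ ∈ (toCompletion F).range) :
    (∃ δ : F, MulAut.conj γ • (H ⊓ G).map (toCompletion F) =
        MulAut.conj (toCompletion F δ) • (H ⊓ G).map (toCompletion F)) ∧
    ((∃ x ∈ H ⊓ G, ∃ y ∈ H ⊓ G, x * y ≠ y * x) → γ ∈ (toCompletion F).range) := by
  by_cases hab : ∀ x ∈ H ⊓ G, ∀ y ∈ H ⊓ G, x * y = y * x
  · refine ⟨profiniteConjugates_a_abelian_of_hcs G H (hHCS G le_rfl inferInstance) hIV hab γ hγ, ?_⟩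
    rintro ⟨x, hx, y, hy, hxy⟩
    exact absurd (hab x hx y hy) hxy
  · have hna : ∃ x ∈ H ⊓ G, ∃ y ∈ H ⊓ G, x * y ≠ y * x := by
      by_contra hne
      refine hab fun x hx y hy => ?_
      by_contra hxy
      exact hne ⟨x, hx, y, hy, hxy⟩
    have hb := profiniteConjugates_b_of_hcs G H hfg hHCS hZ hIII γ hγ hna
    refine ⟨?_, fun _ => hb⟩
    obtain ⟨δ, hδ⟩ := hb
    exact ⟨δ, by rw [hδ]⟩

/-- A conjugacy separable group is residually finite (separate `x ≠ 1` from the class of `1`) — so the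
hypothesis "`G` residually finite" of p. 56 ("we shall write `H, G ⊆ F ⊆ F̂`") is implied by (HCS).
[cite: Mochizuki2012, Thm 2.6 p.56] -/
theorem residuallyFinite_of_conjSeparable {G : Type*} [Group G]
    (hCS : ∀ u v : G, ¬ IsConj u v →
      ∃ (L : Subgroup G) (_ : L.Normal) (_ : L.FiniteIndex),
        ¬ IsConj (QuotientGroup.mk u : G ⧸ L) (QuotientGroup.mk v)) :
    Group.ResiduallyFinite G := by
  rw [Group.residuallyFinite_iff_exists_finiteIndex]
  intro g hg
  obtain ⟨L, _, hLf, hL⟩ := ProfiniteCompletion.exists_finiteIndex_normal_not_mem_of_conjSeparable hCS hg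
  exact ⟨L, hLf, hL⟩

end Assembly


end Literature.IUT.HodgeTheaters
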